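import Summits.ResolutionOfSingularities.ResolutionOfSingularities.Theorems.PurelyInseparableDim4ScopeCover
import Summits.ResolutionOfSingularities.ResolutionOfSingularities.Theorems.PurelyInseparableDim4ComponentThreads
import Summits.ResolutionOfSingularities.ResolutionOfSingularities.Theorems.PurelyInseparableDim4WildConesGapSpecimen
import Mathlib.Data.Nat.Multiplicity
import HarnessLib

/-!
# FIX-X for EVERY `q` over EVERY field: the crossing-line blow-up has an in-scope FIXED POINT
# (cell `res-dim4-pi`, seat res-dim4-p-8 g2; specimen of res-dim4-idea-2 g3 «SPECIMEN FIX-X / LAW X3», whose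
# `q = 3` instance is res-dim4-crit-1's local fixed point `P₁ = x₁x₃²x₄² + x₁³x₂` of V-A-30 (L))

[OURS · counted 0 · a statement about OUR coordinate-centre frame (`CentreBlowup.step`, `PIDim4.Edge`,
`ComponentThreads.IsComponent`, `PIDim4.InCoordinateScope`); an elementary instance of Hironaka's monomial case /
Kollár 2007 Ex. 3.6.2 («memory is needed») one dimension up; nothing here proves or refutes resolution of
singularities in dimension `≥ 4` / characteristic `p`.]

For every `q ≥ 2` and every field `K` let `C₀(q) = x₁x₃^{q−1}x₄^{q−1} + x₁^q x₂` (`fixX q`, bookkeeping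
`r = 0`, `exc = {x₃, x₄}`).  The two PLANES `V(x₁,x₃)`, `V(x₁,x₄)` are components of the `q`-fold coordinate locus
(`isComponent_plane02`, `isComponent_plane03`), their crossing LINE `L = V(x₁,x₃,x₄)` is permissible
(`ord_L C₀ = q`) but NOT a component (`not_isComponent_L`), and **blowing up `L` returns `C₀(q)` LITERALLY at the
origin of the `x₄`-chart and of the `x₃`-chart** (`step_L_three`, `step_L_two`: both exponents are fixed by the
chart law `α′_j = |α|_L − q`, nothing to clean, `r′ = 0`, `exc′ = exc`): `edge_fixX_three/two` — a period-1
in-frame cycle of the «blow up the crossing line of two components» cure, with `b = 0` (so a move of the LOCAL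
game as well as the global one).  For `q = p^e` in characteristic `p` the state is IN COORDINATE SCOPE
(`inCoordinateScope_fixX`: every Hasse derivative of order in `(0, q)` is a single term — Lucas kills
`D^{(a,0,0,0)}(x₁^q x₂)` for `0 < a < q`), so every coordinate rule that blows up the crossing line at such states
has an infinite in-scope branch (`exists_inScope_branch_crossingLine`).  idea-2 g3 checked
`(p,q) ∈ {(2,2),(3,3),(2,4),(5,5),(3,9)}` numerically (hop-g3/fixx.py); eng-w4 g2 (Singular) and crit-1 replayed
`q = 3`; here ALL `q` at once.
bears_on: LADDER-RESOLUTION:D157-DOOR2 (res-dim4-pi · F4-C-loc/glob · crossing-line rule class · every q).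
Supports stmt-ResolutionOfSingularities-16155 (helper).
-/

set_option linter.dupNamespace false -- mandated namespace of this single-conjunct summit

noncomputable section

open MvPolynomial Finset

namespace Summit.ResolutionOfSingularities.ResolutionOfSingularities.Theorems.PIDim4

namespace FixX

open ComponentThreads ScopeCover
open Literature.AlgebraicGeometry.Resolution
open Literature.AlgebraicGeometry.Resolution.CentreBlowup
open Literature.AlgebraicGeometry.Resolution.Hauser2010

variable {K : Type} [Field K]

/-! ## §1 The state -/

/-- exponent of `x₁x₃^{q−1}x₄^{q−1}`. [OURS · specimen] -/
def e1 (q : ℕ) : Fin 4 →₀ ℕ := Finsupp.equivFunOnFinite.symm ![1, 0, q - 1, q - 1]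

/-- exponent of `x₁^q x₂`. [OURS · specimen] -/
def e2 (q : ℕ) : Fin 4 →₀ ℕ := Finsupp.equivFunOnFinite.symm ![q, 1, 0, 0]

/-- Pointwise values of `e1`. -/
@[simp] theorem e1_apply (q : ℕ) (i : Fin 4) : e1 q i = ![1, 0, q - 1, q - 1] i := rfl

/-- Pointwise values of `e2`. -/
@[simp] theorem e2_apply (q : ℕ) (i : Fin 4) : e2 q i = ![q, 1, 0, 0] i := rfl

/-- The two exponents differ (at `x₂`). -/
theorem e1_ne_e2 (q : ℕ) : e1 q ≠ e2 q := by
  intro h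
  have := DFunLike.congr_fun h 1
  simp at this

/-- The crossing line `L = V(x₁, x₃, x₄)`. [OURS · specimen] -/
def L : Finset (Fin 4) := {0, 2, 3}

/-- **`C₀(q)`**: `F = x₁x₃^{q−1}x₄^{q−1} + x₁^q x₂`, `r = 0`, `exc = {x₃, x₄}`. [OURS · specimen] -/
def fixX (q : ℕ) : State K := ⟨monomial (e1 q) 1 + monomial (e2 q) 1, 0, {2, 3}⟩

/-- The polynomial of `fixX q`. -/
theorem fixX_F (q : ℕ) : (fixX (K := K) q).F = monomial (e1 q) 1 + monomial (e2 q) 1 := rfl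

/-- `ord_{(x_S)} C₀(q) = min (|e1|_S, |e2|_S)`. [folklore] -/
theorem ordAlong_fixX (q : ℕ) (S : Finset (Fin 4)) :
    ordAlong S (fixX (K := K) q).F = min (degIn S (e1 q) : ℕ∞) (degIn S (e2 q) : ℕ∞) := by
  rw [fixX_F, ordAlong_monomial_add_monomial S (e1_ne_e2 q) one_ne_zero one_ne_zero]

/-- `|e1|_L = 2q − 1`. -/
theorem degIn_L_e1 (q : ℕ) : degIn L (e1 q) = 1 + (q - 1) + (q - 1) := by
  rw [L, degIn_insert (by decide), degIn_pair (by decide)]; simp; ring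

/-- `|e2|_L = q`. -/
theorem degIn_L_e2 (q : ℕ) : degIn L (e2 q) = q := by
  rw [L, degIn_insert (by decide), degIn_pair (by decide)]; simp

/-- **The crossing line is permissible**: `ord_L C₀(q) = q` (`q ≥ 1`). [folklore] -/
theorem ordAlong_L (q : ℕ) (hq : 1 ≤ q) : ordAlong L (fixX (K := K) q).F = q := by
  rw [ordAlong_fixX, degIn_L_e1, degIn_L_e2, min_eq_right]
  exact_mod_cast (by omega : q ≤ 1 + (q - 1) + (q - 1))

/-- `L` is a Hironaka-permissible coordinate centre of `C₀(q)` (`q ≥ 1`). [folklore] -/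
theorem isPermissibleCentre_L (q : ℕ) (hq : 1 ≤ q) : IsPermissibleCentre q L (fixX (K := K) q).F :=
  ⟨⟨0, by simp [L]⟩, by rw [ordAlong_L q hq]⟩

/-! ## §2 Components: the two planes; the line is a crossing, not a component -/

/-- The plane `V(x₁,x₃)` is a component (`q ≥ 2`). [folklore] -/
theorem isComponent_plane02 (q : ℕ) (hq : 2 ≤ q) : IsComponent q ({0, 2} : Finset (Fin 4)) (fixX (K := K) q).F := by
  refine ⟨⟨⟨0, by simp⟩, ?_⟩, fun k hk hle => ?_⟩
  · rw [ordAlong_fixX, degIn_pair (by decide), degIn_pair (by decide)]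
    simp only [e1_apply, e2_apply, Matrix.cons_val_zero, Matrix.cons_val_two, Matrix.tail_cons,
      Matrix.head_cons, add_zero, le_min_iff]
    exact ⟨by exact_mod_cast (by omega : q ≤ 1 + (q - 1)), le_rfl⟩
  · simp only [Finset.mem_insert, Finset.mem_singleton] at hk
    rcases hk with rfl | rfl
    · rw [show ({0, 2} : Finset (Fin 4)).erase 0 = {2} by decide, ordAlong_fixX, degIn_singleton,
        degIn_singleton] at hle
      simp only [e1_apply, e2_apply, Matrix.cons_val_two, Matrix.tail_cons, Matrix.head_cons] at hle
      have := (le_min_iff.mp hle).2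
      exact absurd (by exact_mod_cast this : q ≤ 0) (by omega)
    · rw [show ({0, 2} : Finset (Fin 4)).erase 2 = {0} by decide, ordAlong_fixX, degIn_singleton,
        degIn_singleton] at hle
      simp only [e1_apply, e2_apply, Matrix.cons_val_zero] at hle
      have := (le_min_iff.mp hle).1
      exact absurd (by exact_mod_cast this : q ≤ 1) (by omega)

/-- The plane `V(x₁,x₄)` is a component (`q ≥ 2`). [folklore] -/
theorem isComponent_plane03 (q : ℕ) (hq : 2 ≤ q) : IsComponent q ({0, 3} : Finset (Fin 4)) (fixX (K := K) q).F := by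
  refine ⟨⟨⟨0, by simp⟩, ?_⟩, fun k hk hle => ?_⟩
  · rw [ordAlong_fixX, degIn_pair (by decide), degIn_pair (by decide)]
    simp only [e1_apply, e2_apply, Matrix.cons_val_zero, Matrix.cons_val_three, Matrix.tail_cons,
      Matrix.head_cons, add_zero, le_min_iff]
    exact ⟨by exact_mod_cast (by omega : q ≤ 1 + (q - 1)), le_rfl⟩
  · simp only [Finset.mem_insert, Finset.mem_singleton] at hk
    rcases hk with rfl | rfl
    · rw [show ({0, 3} : Finset (Fin 4)).erase 0 = {3} by decide, ordAlong_fixX, degIn_singleton,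
        degIn_singleton] at hle
      simp only [e1_apply, e2_apply, Matrix.cons_val_three, Matrix.tail_cons, Matrix.head_cons] at hle
      have := (le_min_iff.mp hle).2
      exact absurd (by exact_mod_cast this : q ≤ 0) (by omega)
    · rw [show ({0, 3} : Finset (Fin 4)).erase 3 = {0} by decide, ordAlong_fixX, degIn_singleton,
        degIn_singleton] at hle
      simp only [e1_apply, e2_apply, Matrix.cons_val_zero] at hle
      have := (le_min_iff.mp hle).1
      exact absurd (by exact_mod_cast this : q ≤ 1) (by omega)

/-- **The crossing line `L` is NOT a component**: its sub-centre `V(x₁,x₃)` is still permissible. [folklore] -/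
theorem not_isComponent_L (q : ℕ) (hq : 2 ≤ q) : ¬ IsComponent q L (fixX (K := K) q).F := by
  intro h
  apply h.2 3 (by simp [L])
  rw [show L.erase 3 = ({0, 2} : Finset (Fin 4)) by decide]
  exact (isComponent_plane02 (K := K) q hq).1.2

/-! ## §3 The fixed point: blowing up `L` returns `C₀(q)` at both chart origins -/

/-- The chart law of the `x_j`-chart (`j ∈ {x₃, x₄}`) fixes `e1`. -/
theorem chartExponent_e1 (q : ℕ) (hq : 1 ≤ q) {j : Fin 4} (hj : j = 2 ∨ j = 3) :
    chartExponent q L j (e1 q) = e1 q := by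
  rw [chartExponent_eq_iff, degIn_L_e1]
  refine ⟨?_, fun i _ => rfl⟩
  rcases hj with rfl | rfl <;> simp <;> omega

/-- The chart law of the `x_j`-chart (`j ∈ {x₃, x₄}`) fixes `e2`. -/
theorem chartExponent_e2 (q : ℕ) {j : Fin 4} (hj : j = 2 ∨ j = 3) :
    chartExponent q L j (e2 q) = e2 q := by
  rw [chartExponent_eq_iff, degIn_L_e2]
  refine ⟨?_, fun i _ => rfl⟩
  rcases hj with rfl | rfl <;> simp

variable [DecidableEq K]

omit [DecidableEq K] in
/-- The point transform at the chart origin is `C₀(q)` itself. -/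
theorem pointTransform_fixX (q : ℕ) (hq : 1 ≤ q) {j : Fin 4} (hj : j = 2 ∨ j = 3) :
    pointTransform q L j (0 : Fin 4 → K) (fixX q) = monomial (e1 q) 1 + monomial (e2 q) 1 := by
  rw [pointTransform, PointBlowup.translate_zero, fixX_F, chartTransform_monomial_add_monomial,
    chartExponent_e1 q hq hj, chartExponent_e2 q hj]

omit [DecidableEq K] in
/-- Neither monomial of `C₀(q)` is a `q`-th power (`q ≥ 2`): cleaning changes nothing. -/
theorem deletePthPowers_fixX (q : ℕ) (hq : 2 ≤ q) :
    deletePthPowers q (monomial (e1 q) (1 : K) + monomial (e2 q) 1) = monomial (e1 q) 1 + monomial (e2 q) 1 := by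
  rw [deletePthPowers_add, deletePthPowers_monomial, deletePthPowers_monomial, if_neg, if_neg]
  · intro h
    have := (isPthPowerExponent_iff q (e2 q)).mp h 1
    simp at this; omega
  · intro h
    have := (isPthPowerExponent_iff q (e1 q)).mp h 0
    simp at this; omega

/-- **FIX-X**: the blow-up of the crossing line `L` returns `C₀(q)` literally at the origin of the `x₄`- or the
`x₃`-chart (`q ≥ 2`). [OURS · every q] -/
theorem step_L (q : ℕ) (hq : 2 ≤ q) {j : Fin 4} (hj : j = 2 ∨ j = 3) :
    CentreBlowup.step q L j (0 : Fin 4 → K) (fixX q) = fixX q := by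
  have hpt := pointTransform_fixX (K := K) q (by omega) hj
  have hr : newMult q L j (0 : Fin 4 → K) (fixX q) = 0 := by
    unfold newMult
    rw [show (fixX (K := K) q).r = 0 from rfl, Finsupp.filter_zero, ordAlong_L q (by omega), ENat.toNat_coe,
      Nat.sub_self]
    ext i; rw [Finsupp.update_apply]; split_ifs <;> rfl
  have he : newExc j (0 : Fin 4 → K) (fixX q) = ({2, 3} : Finset (Fin 4)) := by
    unfold newExc
    rw [show (fixX (K := K) q).exc = ({2, 3} : Finset (Fin 4)) from rfl]
    ext i
    simp only [Finset.mem_insert, Finset.mem_filter, Finset.mem_singleton, Pi.zero_apply, and_true]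
    rcases hj with rfl | rfl <;> tauto
  unfold CentreBlowup.step
  rw [hpt, deletePthPowers_fixX q hq, hr, he]; rfl

omit [DecidableEq K] in
/-- The chart origin is an equimultiple point (the transform has no monomial of degree `< q`). -/
theorem isEquimultiplePoint_fixX (q : ℕ) (hq : 1 ≤ q) {j : Fin 4} (hj : j = 2 ∨ j = 3) :
    IsEquimultiplePoint q L j (0 : Fin 4 → K) (fixX q) := by
  intro d _ hdlt
  rw [pointTransform_fixX q hq hj, coeff_add, coeff_monomial, coeff_monomial, if_neg, if_neg, add_zero]
  · rintro rfl
    rw [← degIn_univ, Trap1.degIn_univ4] at hdlt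
    simp at hdlt
  · rintro rfl
    rw [← degIn_univ, Trap1.degIn_univ4] at hdlt
    simp at hdlt; omega

omit [DecidableEq K] in
/-- `C₀(q) ≠ 0`. -/
theorem fixX_F_ne_zero (q : ℕ) : (fixX (K := K) q).F ≠ 0 := by
  intro h
  have := congrArg (coeff (e1 q)) h
  rw [fixX_F, coeff_add, coeff_monomial, coeff_monomial, if_pos rfl, if_neg (e1_ne_e2 q).symm,
    coeff_zero] at this
  simp at this

/-- **The fixed point is an `Edge`** of the frame along `L` (`x₄`- or `x₃`-chart, point `b = 0`; `q ≥ 2`).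
[OURS · every q] -/
theorem edge_fixX (q : ℕ) (hq : 2 ≤ q) {j : Fin 4} (hj : j = 2 ∨ j = 3) :
    Edge q L (fixX (K := K) q) (fixX q) := by
  refine ⟨j, 0, ?_, rfl, isEquimultiplePoint_fixX q (by omega) hj, ?_, (step_L q hq hj).symm⟩
  · rcases hj with rfl | rfl <;> simp [L]
  · rw [step_L q hq hj]; exact fixX_F_ne_zero q

/-- Hence every coordinate rule that blows up the crossing line `L` at `C₀(q)` has the constant infinite
branch `C₀(q), C₀(q), …` (`StepRule`), over every field, for every `q ≥ 2`. [OURS · every q] -/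
theorem exists_branch_crossingLine (q : ℕ) (hq : 2 ≤ q) (R : CentreRule K) (hR : R (fixX q) = L) :
    ∃ c : ℕ → State K, ∀ k, c k = fixX q ∧ StepRule q R (c k) (c (k + 1)) :=
  ⟨fun _ => fixX q, fun _ => ⟨rfl, hR ▸ isPermissibleCentre_L q (by omega), hR ▸ edge_fixX q hq (Or.inr rfl)⟩⟩

/-! ## §4 In scope for `q = p^e` -/

omit [DecidableEq K] in
/-- **Lucas kills the cross term**: in characteristic `p`, `D^{(α)}(x₁^{p^e} x₂) = 0` whenever `α` has no `x₂`
and `0 < |α| < p^e`. [folklore] -/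
theorem hasseDeriv_e2_eq_zero (p e : ℕ) [hp : Fact p.Prime] [CharP K p] {α : Fin 4 →₀ ℕ}
    (hα1 : α 1 = 0) (h0 : 0 < α.degree) (hq : α.degree < p ^ e) :
    hasseDeriv α (monomial (e2 (p ^ e)) (1 : K)) = 0 := by
  classical
  by_cases hle : α ≤ e2 (p ^ e)
  · have h2 : α 2 = 0 := Nat.le_zero.mp (by simpa using hle 2)
    have h3 : α 3 = 0 := Nat.le_zero.mp (by simpa using hle 3)
    have hdeg : α.degree = α 0 := by
      rw [← degIn_univ, Trap1.degIn_univ4, hα1, h2, h3]; omega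
    rw [UniformTrapScope.hasseDeriv_monomial' _ _ _ hle, mul_one]
    have hprod : (∏ i, (Nat.choose (e2 (p ^ e) i) (α i) : K)) = (Nat.choose (p ^ e) (α 0) : K) := by
      rw [Fin.prod_univ_four]
      simp [hα1, h2, h3]
    have hdvd : p ∣ Nat.choose (p ^ e) (α 0) :=
      hp.out.dvd_choose_pow (by omega) (by omega)
    rw [hprod, (CharP.cast_eq_zero_iff K p _).mpr hdvd, map_zero]
  · exact WildConesBridge.hasseDeriv_monomial_of_not_le 1 hle

omit [DecidableEq K] in
/-- **`C₀(p^e)` IS IN COORDINATE SCOPE in characteristic `p`**: every Hasse derivative of order in `(0, p^e)` is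
a single term. [OURS · every prime power] -/
theorem inCoordinateScope_fixX (p e : ℕ) [Fact p.Prime] [CharP K p] :
    InCoordinateScope (p ^ e) (fixX (K := K) (p ^ e)).F := by
  classical
  refine inCoordinateScope_of_terms fun α h0 hq => ?_
  rw [fixX_F, IsolatedBand.hasseDeriv_add]
  by_cases hα1 : α 1 = 0
  · rw [hasseDeriv_e2_eq_zero p e hα1 h0 hq, add_zero]
    exact hasseDeriv_monomial_isTerm α (e1 (p ^ e)) 1
  · have hnle : ¬ α ≤ e1 (p ^ e) := fun hle => hα1 (Nat.le_zero.mp (by simpa using hle 1))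
    rw [WildConesBridge.hasseDeriv_monomial_of_not_le 1 hnle, zero_add]
    exact hasseDeriv_monomial_isTerm α (e2 (p ^ e)) 1

/-- **FIX-X, in-scope rule form**: in characteristic `p`, for every `e ≥ 1`, every coordinate rule that picks the
crossing line `L` at `C₀(p^e)` has an infinite IN-SCOPE branch (the fixed point). [OURS · every prime power] -/
theorem exists_inScope_branch_crossingLine (p e : ℕ) [Fact p.Prime] [CharP K p] (he : 1 ≤ e)
    (R : CentreRule K) (hR : R (fixX (p ^ e)) = L) :
    ∃ c : ℕ → State K, ∀ k, InCoordinateScope (p ^ e) (c k).F ∧ StepRule (p ^ e) R (c k) (c (k + 1)) := by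
  have hq : 2 ≤ p ^ e := le_trans (Nat.Prime.two_le Fact.out) (Nat.le_self_pow (by omega) p)
  obtain ⟨c, hc⟩ := exists_branch_crossingLine (K := K) (p ^ e) hq R hR
  exact ⟨c, fun k => ⟨(hc k).1 ▸ inCoordinateScope_fixX p e, (hc k).2⟩⟩

end FixX

end Summit.ResolutionOfSingularities.ResolutionOfSingularities.Theorems.PIDim4

end
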